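import Summits.ResolutionOfSingularities.ResolutionOfSingularities.Theorems.EquisingularLiftEquisingularLiftNatConeDeltaPlaneCharts
import HarnessLib

/-!
# [OURS · L1 W4.5(b) · EL♮(3)] B7★ CONE-DELTA TRANSPORT (3/3): the localised-polynomial presentation of the CARRIER stalk
# `𝒪_{X₁,p_c} ⧸ (e₀) ≅ Λ[U₁,U₂]_𝔫` from a chart presentation `𝒪_{X₁,p_c} ≅ (R[c/c₀])_𝔔₀` of the stage's stalk (B1★ currency),
# and `TCPlus.ConeDeltaRegular c′ Φ′` at the cone point straight from that presentation + T-ΔLIFT-CENTRED's chart clauses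
# (crux `EquisingularLiftNatThree` stmt-ResolutionOfSingularities-20148 / parent 20038; rung v7 TC⁺, brick `inv_base`)

NOT a statement of any manuscript. Helper file of the chain res-L1-w45b (cell `res-hironaka`, LADDER-RESOLUTION rung L, slot W4.5(b));
OURS; AI-written, weaker than expert review; `--supports stmt-ResolutionOfSingularities-20148 --as helper` by res-L1-w45b-stub-3 (object
B7★ of the K8/INV board, res-L1-w45b-stub-1 RULING 2026-08-27T13:44:20Z). No `sorry`; standard axioms. It closes nothing by itself.

WHERE IT SITS. res-type-100's `inv_base` (B6) builds the `TCPlus.CentredPackage` at the cone point `p_c ∈ X₁` from the chart-0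
presentation of the stalk (res-D-pv-029's B1★ `exists_blowupAlgebra_stalk_ringEquiv_of_stalkIdeal_eq_span`): `R = 𝒪_{X′,jx}` with the
quasi-regular frame `c = (c₀,c₁,c₂)` of the section, `θ : R/(c) ≅ Λ` (`Λ = O`), `χ : R[c/c₀] → A = 𝒪_{X₁,p_c}` presenting `A` as
`(R[c/c₀])_𝔔₀` with `𝔔₀ ∩ R = 𝔪_R`; the new frame is `c′ = (χ(c₀/1), χ(c₁/c₀), χ(c₂/c₀))`. Parts 1–2 (…NatPlaneChartLocalization,
…NatConeDeltaPlaneCharts) want the carrier `A/(c′₀)` presented as a localisation `ψ : Λ[U₁,U₂] → A/(c′₀)` at a prime `𝔫`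
with `ψ(U_l) = c̄′_{l+1}`. THIS FILE supplies that presentation and the end-to-end statement:

* `exists_chartZero_quotient_hom` — the reduction map `Θ : R[c/c₀] ↠ Λ[U₁,U₂]` (`r ↦ θ(r̄)`, `c_{l+1}/c₀ ↦ U_l`) with kernel
  `(c₀/1)`: Literature `blowupAlgebraQuotEquiv` (`R[c/c₀]/(c₀) ≅ (R/(c))[T_l : l ≠ 0]`, Stacks 0BIQ) reindexed by
  `finSuccAboveEquiv 0` and pushed along `θ`;
* `exists_carrierPresentation_of_chart` — for ANY surjection `Θ : B ↠ P` with kernel `(b₀) ⊆ 𝔔₀` and a model `A` of `B_𝔔₀` along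
  `χ`: a presentation `ψ : P → A ⧸ (χ b₀)` as the localisation at the prime `Θ(𝔔₀)` with `ψ ∘ Θ = (mod χ b₀) ∘ χ` and
  `Θ b ∈ Θ(𝔔₀) ↔ χ b ∈ 𝔪_A` (localisation commutes with quotients: res-L1-w45b-stub-2 `isLocalization_atPrime_quotient_of_surjective`,
  p535712);
* **`coneDeltaRegular_of_chartPresentation`** — `TCPlus.ConeDeltaRegular c′ Φ′` from: the chart-0 presentation `(c, hc, θ, χ, 𝔔₀)`
  of `A`, the frame equations for `c′`, the RSOP side conditions at `A` (`(c′) + (ϖ_A) = 𝔪_A`, `dim A = 4`), the cone form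
  `Φ′ ∈ A[Z₁,Z₂]_m` with `Φ′ mod 𝔪_A ≠ 0` and `Φ′(c′₁,c′₂) ≡ χ(Φ_R(c/c₀)) (mod c′₀)` for a lift `Φ_R ∈ R[T₀,T₁,T₂]` of
  `Φ ∈ Λ[T₀,T₁,T₂]`, and T-ΔLIFT-CENTRED's (p523916) two chart clauses for `Φu`, `Φv` with `ϖ = θ(ϖ̄_R)`, `ϖ_R ∈ 𝔪_R`.

References: The Stacks Project, Tag 0BIQ; U. Görtz, T. Wedhorn, *Algebraic Geometry I* (2020), Prop. 13.96 (2) p. 416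
[cite: GortzWedhorn2020]; H. Matsumura, *Commutative Ring Theory* (1986), Thm. 14.2 [cite: Matsumura1987]. Tree inputs: parts 1–2,
p535712 (γ), Literature BlowupAlgebraQuasiRegularChart (`blowupAlgebraQuotEquiv_C/_X`).
-/

set_option linter.dupNamespace false -- mandated namespace `Summit.<Summit>.<Problem>` of this single-conjunct summit

noncomputable section

namespace Summit.ResolutionOfSingularities.ResolutionOfSingularities.Cruxes.EquisingularLiftNat.Sections.TCPlus

open MvPolynomial IsLocalRing Literature.AlgebraicGeometry.Resolution
open Summit.ResolutionOfSingularities.ResolutionOfSingularities.Cruxes.EquisingularLiftNat.Sections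

universe u

/-! ## The reduction map `Θ : R[c/c₀] ↠ Λ[U₁,U₂]` -/

section Reduction

variable {R : Type u} [CommRing R] (c : Fin 3 → R) {Λ : Type u} [CommRing Λ]
  (θ : (R ⧸ Ideal.span (Set.range c)) ≃+* Λ)

/-- **`R[c/c₀] ↠ Λ[U₁,U₂]`, `r ↦ θ(r̄)`, `c_{l+1}/c₀ ↦ U_l`, with kernel `(c₀/1)`** (`c` quasi-regular, `θ : R/(c) ≅ Λ`): the
exceptional divisor of the chart `c₀` is the affine plane over the centre (Literature `blowupAlgebraQuotEquiv`, reindexed along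
`{l : Fin 3 // l ≠ 0} ≃ Fin 2` and pushed along `θ`). [cite: StacksProject, Tag 0BIQ] -/
theorem exists_chartZero_quotient_hom (hc : IsQuasiRegular c) :
    ∃ Θ : blowupAlgebra (Ideal.span (Set.range c)) (c 0) →+* MvPolynomial (Fin 2) Λ,
      Function.Surjective Θ ∧
      RingHom.ker Θ = Ideal.span {algebraMap R (blowupAlgebra (Ideal.span (Set.range c)) (c 0)) (c 0)} ∧
      (∀ r : R, Θ (algebraMap R _ r) = MvPolynomial.C (θ (Ideal.Quotient.mk (Ideal.span (Set.range c)) r))) ∧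
      (∀ l : Fin 2, Θ (blowupAlgebra.frac c 0 l.succ) = MvPolynomial.X l) := by
  classical
  let e₂ : {x : Fin 3 // x ≠ 0} ≃ Fin 2 := (finSuccAboveEquiv (0 : Fin 3)).symm
  have he₂ : ∀ l : Fin 2, e₂ ⟨l.succ, Fin.succ_ne_zero l⟩ = l := fun l => by
    rw [Equiv.symm_apply_eq, finSuccAboveEquiv_apply]
    exact Subtype.ext (by simp)
  let ε : (blowupAlgebra (Ideal.span (Set.range c)) (c 0) ⧸
      Ideal.span {algebraMap R (blowupAlgebra (Ideal.span (Set.range c)) (c 0)) (c 0)}) ≃+* MvPolynomial (Fin 2) Λ :=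
    ((blowupAlgebraQuotEquiv c 0 hc).symm.trans
      (MvPolynomial.renameEquiv (R ⧸ Ideal.span (Set.range c)) e₂).toRingEquiv).trans (MvPolynomial.mapEquiv (Fin 2) θ)
  have hε : ∀ p, ε (blowupAlgebraQuotEquiv c 0 hc p) = MvPolynomial.map (θ : _ →+* Λ) (MvPolynomial.rename e₂ p) := by
    intro p
    simp only [ε, RingEquiv.trans_apply, RingEquiv.symm_apply_apply, AlgEquiv.coe_ringEquiv,
      MvPolynomial.renameEquiv_apply, MvPolynomial.mapEquiv_apply]
  refine ⟨ε.toRingHom.comp (Ideal.Quotient.mk _), ε.surjective.comp Ideal.Quotient.mk_surjective,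
    by rw [RingHom.ker_equiv_comp, Ideal.mk_ker], fun r => ?_, fun l => ?_⟩
  · rw [RingHom.comp_apply, RingEquiv.toRingHom_eq_coe, RingHom.coe_coe, ← blowupAlgebraQuotEquiv_C c 0 hc r, hε,
      MvPolynomial.rename_C, MvPolynomial.map_C]
    rfl
  · rw [RingHom.comp_apply, RingEquiv.toRingHom_eq_coe, RingHom.coe_coe]
    have h := blowupAlgebraQuotEquiv_X c 0 hc ⟨l.succ, Fin.succ_ne_zero l⟩
    rw [show blowupAlgebra.gen (Ideal.span (Set.range c)) (c 0) (c (⟨l.succ, Fin.succ_ne_zero l⟩ : {x : Fin 3 // x ≠ 0}).1)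
        (Ideal.mem_span_range_self (f := c) (x := (⟨l.succ, Fin.succ_ne_zero l⟩ : {x : Fin 3 // x ≠ 0}).1)) =
        blowupAlgebra.frac c 0 l.succ from rfl] at h
    rw [← h, hε, MvPolynomial.rename_X, MvPolynomial.map_X, he₂]

end Reduction

/-! ## Localisation commutes with quotients: the carrier presentation -/

section Presentation

/-- **The carrier presentation.** `χ : B → A` presenting the local ring `A` as `B_𝔔₀`, `Θ : B ↠ P` surjective with kernel `(b₀)`,
`b₀ ∈ 𝔔₀`, `a₀ = χ(b₀)`. Then there are `ψ : P → A/(a₀)` and a prime `𝔫` of `P` (namely `Θ(𝔔₀)`) with: `A/(a₀)` is the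
localisation of `P` at `𝔫` along `ψ`; `ψ(Θ b) = χ(b) mod a₀`; `Θ b ∈ 𝔫 ↔ χ b ∈ 𝔪_A`.
[cite: GortzWedhorn2020, Prop. 13.96 (2) p. 416] [OURS · L1 W4.5b] B7★; NOT a statement of the manuscript. -/
theorem exists_carrierPresentation_of_chart {B A P : Type u} [CommRing B] [CommRing A] [CommRing P] [IsLocalRing A]
    (χ : B →+* A) (𝔔₀ : Ideal B) [𝔔₀.IsPrime] (hlocA : @IsLocalization.AtPrime _ _ A _ χ.toAlgebra 𝔔₀ _)
    (Θ : B →+* P) (hΘ : Function.Surjective Θ) {b₀ : B} (hker : RingHom.ker Θ = Ideal.span {b₀}) (hb₀ : b₀ ∈ 𝔔₀)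
    {a₀ : A} (ha₀ : a₀ = χ b₀) :
    ∃ (ψ : P →+* A ⧸ Ideal.span ({a₀} : Set A)) (𝔫 : PrimeSpectrum P),
      @IsLocalization.AtPrime _ _ (A ⧸ Ideal.span ({a₀} : Set A)) _ ψ.toAlgebra 𝔫.asIdeal _ ∧
      (∀ b, ψ (Θ b) = Ideal.Quotient.mk _ (χ b)) ∧
      (∀ b, Θ b ∈ 𝔫.asIdeal ↔ χ b ∈ maximalIdeal A) := by
  subst ha₀
  letI := χ.toAlgebra
  haveI := hlocA
  have hkerle : RingHom.ker Θ ≤ 𝔔₀ := by rw [hker, Ideal.span_singleton_le_iff_mem]; exact hb₀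
  haveI h𝔫 : (𝔔₀.map Θ).IsPrime := Ideal.map_isPrime_of_surjective hΘ hkerle
  obtain ⟨φ, hφ⟩ := exists_lift_quotient_map_ker Θ hΘ (S := A)
  have hloc := isLocalization_atPrime_quotient_of_surjective Θ hΘ 𝔔₀ hkerle φ hφ
  have hJ : Ideal.span ({χ b₀} : Set A) = (RingHom.ker Θ).map (algebraMap B A) := by
    rw [hker, Ideal.map_span, Set.image_singleton]
    rfl
  have hcomap : (𝔔₀.map Θ).comap Θ = 𝔔₀ := by
    rw [Ideal.comap_map_of_surjective _ hΘ, ← RingHom.ker_eq_comap_bot, sup_eq_left.mpr hkerle]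
  have hmem : ∀ b, Θ b ∈ 𝔔₀.map Θ ↔ χ b ∈ maximalIdeal A := fun b => by
    rw [← Ideal.mem_comap, hcomap]
    exact (IsLocalization.AtPrime.to_map_mem_maximal_iff A 𝔔₀ b).symm
  -- transport from `A ⧸ (ker Θ)·A` to `A ⧸ (χ b₀)` along the equality of ideals
  suffices key : ∀ J : Ideal A, J = (RingHom.ker Θ).map (algebraMap B A) →
      ∃ (ψ : P →+* A ⧸ J) (𝔫 : PrimeSpectrum P), @IsLocalization.AtPrime _ _ (A ⧸ J) _ ψ.toAlgebra 𝔫.asIdeal _ ∧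
        (∀ b, ψ (Θ b) = Ideal.Quotient.mk _ (χ b)) ∧ (∀ b, Θ b ∈ 𝔫.asIdeal ↔ χ b ∈ maximalIdeal A) from key _ hJ
  intro J hJ'
  subst hJ'
  exact ⟨φ, ⟨𝔔₀.map Θ, h𝔫⟩, hloc, hφ, hmem⟩

end Presentation

/-! ## `ConeDeltaRegular` at the cone point from the chart presentation -/

section ConePoint

/-- A proper centre of a local ring lies in the maximal ideal: `(c) ≤ 𝔪_R` as soon as `R/(c) ≅ Λ` is nontrivial. [folklore] -/
theorem span_range_le_maximalIdeal_of_equiv {R : Type u} [CommRing R] [IsLocalRing R] {r : ℕ} (c : Fin r → R)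
    {Λ : Type u} [CommRing Λ] [Nontrivial Λ] (θ : (R ⧸ Ideal.span (Set.range c)) ≃+* Λ) :
    Ideal.span (Set.range c) ≤ maximalIdeal R := by
  refine IsLocalRing.le_maximalIdeal fun h => ?_
  haveI : Nontrivial (R ⧸ Ideal.span (Set.range c)) := θ.symm.injective.nontrivial
  exact not_subsingleton (R ⧸ Ideal.span (Set.range c)) (Ideal.Quotient.subsingleton_iff.mpr h)

/-- **B7★ CONE-DELTA TRANSPORT, end to end: `TCPlus.ConeDeltaRegular c′ Φ′` at the cone point from the chart-0 presentation of the
stalk and the two plane chart clauses of T-ΔLIFT-CENTRED.** Data: `R` local with a quasi-regular frame `c = (c₀,c₁,c₂)` and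
`θ : R/(c) ≅ Λ` (`Λ` a domain; in use `Λ = O`); `A` Noetherian local presented by `χ : R[c/c₀] → A` as `(R[c/c₀])_𝔔₀`, `𝔔₀ ∩ R = 𝔪_R`;
the frame `c′ = (χ(c₀/1), χ(c₁/c₀), χ(c₂/c₀))` with `(c′) + (ϖ_A) = 𝔪_A`, `dim A = 4`; the cone form `Φ′ ∈ A[Z₁,Z₂]_m`, `Φ′ mod 𝔪_A ≠ 0`,
with `Φ′(c′₁,c′₂) ≡ χ(Φ_R(c/c₀)) (mod c′₀)` for a lift `Φ_R` of `Φ ∈ Λ[T₀,T₁,T₂]`; p523916's clauses `Φ(1,X,XY) = Xᵐ·Φu`,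
`Φ(1,XY,Y) = Yᵐ·Φv` and regularity of the local rings of `Λ[X,Y]/(Φu)`, `Λ[X,Y]/(Φv)` at primes containing `C ϖ`, `ϖ = θ(ϖ̄_R)`,
`ϖ_R ∈ 𝔪_R`. [cite: Matsumura1987, Thm. 14.2] [OURS · L1 W4.5b] B7★ for res-type-100's `inv_base` B6 (CentredPackage at `p_c`);
NOT a statement of the manuscript. -/
theorem coneDeltaRegular_of_chartPresentation
    {R : Type u} [CommRing R] [IsLocalRing R] (c : Fin 3 → R) (hc : IsQuasiRegular c)
    {Λ : Type u} [CommRing Λ] [IsDomain Λ] (θ : (R ⧸ Ideal.span (Set.range c)) ≃+* Λ)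
    {A : Type u} [CommRing A] [IsLocalRing A] [IsNoetherianRing A]
    (χ : blowupAlgebra (Ideal.span (Set.range c)) (c 0) →+* A)
    (𝔔₀ : Ideal (blowupAlgebra (Ideal.span (Set.range c)) (c 0))) [𝔔₀.IsPrime]
    (hlocA : @IsLocalization.AtPrime _ _ A _ χ.toAlgebra 𝔔₀ _)
    (h𝔔₀ : 𝔔₀.comap (algebraMap R _) = maximalIdeal R)
    (c' : Fin 3 → A) (hc'0 : c' 0 = χ (algebraMap R _ (c 0)))
    (hc'succ : ∀ l : Fin 2, c' l.succ = χ (blowupAlgebra.frac c 0 l.succ))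
    (ϖA : A) (h𝔪 : Ideal.span (Set.range c') ⊔ Ideal.span {ϖA} = maximalIdeal A) (hdim : ringKrullDim A = (2 + 2 : ℕ))
    (Φ' : MvPolynomial (Fin 2) A) {m : ℕ} (hΦ'd : Φ'.IsHomogeneous m)
    (hΦ'𝔪 : MvPolynomial.map (IsLocalRing.residue A) Φ' ≠ 0)
    (ΦR : MvPolynomial (Fin 3) R) (Φ : MvPolynomial (Fin 3) Λ)
    (hΦR : MvPolynomial.map (θ.toRingHom.comp (Ideal.Quotient.mk (Ideal.span (Set.range c)))) ΦR = Φ)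
    (hΦ' : Ideal.Quotient.mk (Ideal.span ({c' 0} : Set A)) (MvPolynomial.eval (fun l : Fin 2 => c' l.succ) Φ') =
      Ideal.Quotient.mk (Ideal.span ({c' 0} : Set A)) (χ (MvPolynomial.aeval (blowupAlgebra.frac c 0) ΦR)))
    (ϖR : R) (hϖR : ϖR ∈ maximalIdeal R) (ϖ : Λ) (hϖ : θ (Ideal.Quotient.mk (Ideal.span (Set.range c)) ϖR) = ϖ)
    (Φu Φv : MvPolynomial (Fin 2) Λ)
    (hΦu : MvPolynomial.aeval (![1, X 0, X 0 * X 1] : Fin 3 → MvPolynomial (Fin 2) Λ) Φ = X 0 ^ m * Φu)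
    (hΦv : MvPolynomial.aeval (![1, X 0 * X 1, X 1] : Fin 3 → MvPolynomial (Fin 2) Λ) Φ = X 1 ^ m * Φv)
    (hregu : ∀ (Q : Ideal (MvPolynomial (Fin 2) Λ ⧸ Ideal.span {Φu})) [Q.IsPrime],
      Ideal.Quotient.mk (Ideal.span {Φu}) (MvPolynomial.C ϖ) ∈ Q → IsRegularLocalRing (Localization.AtPrime Q))
    (hregv : ∀ (Q : Ideal (MvPolynomial (Fin 2) Λ ⧸ Ideal.span {Φv})) [Q.IsPrime],
      Ideal.Quotient.mk (Ideal.span {Φv}) (MvPolynomial.C ϖ) ∈ Q → IsRegularLocalRing (Localization.AtPrime Q)) :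
    ConeDeltaRegular c' Φ' := by
  classical
  obtain ⟨Θ, hΘsurj, hΘker, hΘC, hΘX⟩ := exists_chartZero_quotient_hom c θ hc
  have hc0𝔔 : algebraMap R (blowupAlgebra (Ideal.span (Set.range c)) (c 0)) (c 0) ∈ 𝔔₀ := by
    rw [← Ideal.mem_comap, h𝔔₀]
    exact span_range_le_maximalIdeal_of_equiv c θ (Ideal.subset_span (Set.mem_range_self 0))
  obtain ⟨ψ, 𝔫, hloc, hψΘ, hmem⟩ := exists_carrierPresentation_of_chart χ 𝔔₀ hlocA Θ hΘsurj hΘker hc0𝔔 hc'0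
  -- the cone germ reduces to `Φ(1, U₁, U₂)`
  have hf : Θ.comp (algebraMap R (blowupAlgebra (Ideal.span (Set.range c)) (c 0))) =
      (algebraMap Λ (MvPolynomial (Fin 2) Λ)).comp (θ.toRingHom.comp (Ideal.Quotient.mk (Ideal.span (Set.range c)))) :=
    RingHom.ext fun r => by
      simp only [RingHom.comp_apply, hΘC, MvPolynomial.algebraMap_eq]
      rfl
  have hg : (fun i => Θ (blowupAlgebra.frac c 0 i)) = (![1, X 0, X 1] : Fin 3 → MvPolynomial (Fin 2) Λ) := by
    funext i
    refine Fin.cases ?_ (fun l => ?_) i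
    · rw [show blowupAlgebra.frac c 0 0 = 1 from blowupAlgebra.gen_self _ _ _, map_one]
      rfl
    · rw [hΘX]
      have hl : l = 0 ∨ l = 1 := by fin_cases l <;> simp
      rcases hl with rfl | rfl <;> rfl
  have hΘcone : Θ (MvPolynomial.aeval (blowupAlgebra.frac c 0) ΦR) =
      MvPolynomial.aeval (![1, X 0, X 1] : Fin 3 → MvPolynomial (Fin 2) Λ) Φ := by
    rw [MvPolynomial.map_aeval, hf, hg, ← hΦR, MvPolynomial.aeval_def, MvPolynomial.eval₂_map]
    rfl
  refine coneDeltaRegular_of_planeCharts c' Φ' ϖ ψ 𝔫.asIdeal ϖA h𝔪 hdim hΦ'd hΦ'𝔪 hloc ?_ ?_ Φ Φu Φv hΦu hΦv ?_ hregu hregv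
  · -- `C ϖ ∈ 𝔫`
    rw [← hϖ, ← hΘC, hmem]
    letI := χ.toAlgebra
    haveI := hlocA
    exact (IsLocalization.AtPrime.to_map_mem_maximal_iff A 𝔔₀ _).mpr (by rw [← Ideal.mem_comap, h𝔔₀]; exact hϖR)
  · intro l
    rw [← hΘX, hψΘ, hc'succ]
  · rw [hΦ', ← hψΘ, hΘcone]

end ConePoint

end Summit.ResolutionOfSingularities.ResolutionOfSingularities.Cruxes.EquisingularLiftNat.Sections.TCPlus

end
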